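import Summits.QuantumFields.BalabanUV.T4Continuum.Support.NE7MinActC2Lift
import Summits.QuantumFields.BalabanUV.T4Continuum.Support.NE7SecondOrderChainRule
import Summits.QuantumFields.BalabanUV.T4Continuum.Support.NE7MinimiserC1Flat
import Summits.QuantumFields.BalabanUV.T4Continuum.Support.NE7FibreStraightening
import HarnessLib

/-!
# NE7MinActHessianFlat — THE HESSIAN OF THE CONSTRAINED MINIMAL ACTION AT THE FLAT DATUM IS THE VARIATIONAL QUADRATIC FORM OF THE AVERAGING CONSTRAINT (ROAD-G115 §2;
# ROAD-G114 §11 (v) «Bałaban's Δ_k» CLOSED in its variational form)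

For `d = 4`, every `U(n)`, every `L ≥ 2`, `0 < ε ≤ ε₀`, `N ≥ 1` and every level `j+1` (`M = L·tower j`, `w = stepWt⁻ʲ⁻¹`): the constrained minimal action read in the exponential chart at the
flat datum, `m(y) := minAct(chart_1 y)` (`y ∈ skewSub N`), is `C²` at `0`, and for every coarse direction `v`
`D²m(0)[v, v] = min { w·D²𝒜(0)[X, X] : X ∈ skewSub M, Q′X = v }`, the minimum being ATTAINED — where `𝒜(X) = fineAction(chart_1 X)` is the fine Wilson action in the exponential chart at
the flat fine configuration (so `D²𝒜(0)` is the free lattice quadratic form) and `Q′ = levelQ′ L N j 1` is the linearised `(j+1)`-fold block-averaging map (**`minAct_hessian_flat`**,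
stated with `IsLeast`).  This is the VARIATIONAL DEFINITION of the quadratic form of the `(j+1)`-step effective action at the flat background (the form Bałaban writes `⟨B, Δ_k B⟩` and
obtains by minimising the free action under the averaging constraint) — derived here from the nonlinear constrained minimisation, not posited.
MECHANISM.  (≥, attained) `NE7MinActC2Lift.minAct_contDiffAt_two_of_lift` at `(1, 1)` (lift hypothesis discharged by `stab_flatCfg_const`): `D²m(0)[v,v] = w·D²g(0)[(v, ζ⋆)]²` with
`g = 𝒜 ∘ Θ`, `Θ(y, z) = θ_Σ(y, ι_K z)`; `D𝒜(0) = 0` at the flat configuration (`𝒜 ≥ 0 = 𝒜(0)` on skew fields), so `NE7SecondOrderChainRule.fderiv_fderiv_comp_of_fderiv_eq_zero` gives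
`D²g(0)[u]² = D²𝒜(0)[DΘ(0)u]²`, and `Q′(DΘ(0)(v, ζ)) = v` by differentiating the straightening identity `Q̄(chart θ_Σ(y, s)) = y`.  (≤) for `X` with `Q′X = v` the fibre straightening `θ` of
✓ p821389 `NE7FibreStraightening.fibre_straightening` gives admissible competitors `chart_1 θ(tv, tX)` over `chart_1(tv)`, so `φ(t) := w·𝒜(θ(tv, tX)) − m(tv) ≥ 0 = φ(0)` near `0`; `φ` is `C²`,
hence `φ″(0) ≥ 0` (✓ p823109 `second_derivative_ge_of_quadratic_growth` with `c = 0`), and `φ″(0) = w·D²𝒜(0)[X, X] − D²m(0)[v, v]` by `fderiv_fderiv_const_mul_sub`, `fderiv_fderiv_comp_clm`,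
`fderiv_fderiv_comp_of_fderiv_eq_zero` and `Dθ(0)(Q′X, X) = X` (the derivative of the identity `θ(Q̄Φ, Φ) = Φ`).
Cell `pub-balaban`, rung (B)+1 sub-cell t4, lineage `b2b-balaban-t4-ne7-p1` (CRUX PROVER NE7 #1 = OWNER of BINDER row NE7), generation 115.  Memo `t4/b2b-balaban-t4-ne7-p1-g115/ROAD-G115.md` §2.
WHAT ([folklore]; 0 def, 0 sorry; `d = 4`, every `U(n)`, `L ≥ 2`).  HONEST FRAMING (page 1): a theorem about OUR constrained minimisation (B11 (8) with `sfClass`) at the flat datum; the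
quadratic form is characterised VARIATIONALLY — no closed formula (Bałaban's explicit `Δ_k = a_k Q_k G_k … ` operator algebra is NOT derived here), no spectral bounds, no `k`-uniformity;
nothing of Bałaban's asserted; NOT NE7 as a spine node, NOT NE3; spine 0∕9; finite T⁴ rung (B)+1 — NOT infinite volume, NOT mass gap, NOT BetaPertH, NOT Clay.
-/

set_option autoImplicit false

open scoped BigOperators Matrix Matrix.Norms.L2Operator Topology
open NormedSpace Finset Set Filter Metric

namespace Summit.QuantumFields.BalabanUV.T4Continuum.NE7MinActHessianFlat

open Literature.MathematicalPhysics.QuantumFieldTheory.Balaban1983to89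
open B7Prop1Explicit B7Prop2Explicit
open T4AveragingDeficitWall (IsUnitaryCfg SmallField fineAction)
open T4AveragingDeficitWallBoundary (IsPeriodicCfg)
open AveragingDeficitTorusChart (TDir chart chartDir chart_zero chart_smul redN isPeriodicCfg_chart isUnitaryCfg_chart)
open AveragingDeficitChartCalculus (relLog contDiffAt_fineAction_chart)
open AveragingDeficitTwoLevelPrep (skewSub skewPR)
open AveragingDeficitMultiLevelPrep (tower levelQ levelQ' levelQ_self tower_ne_zero)
open AveragingDeficitMultiLevelFermat (hasStrictFDerivAt_levelQ)
open MinimalActionLevels (perWin levelAction stepWt stepWt_pos fineAction_nonneg)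
open MinimalActionSandwich (IsMinimiser admissible minAct)
open MinimalActionRate (sfClass)
open MinimalActionWitness (flatCfg isMinimiser_sfClass_flatCfg flatCfg_mem_sfClass isPeriodicCfg_flatCfg fineAction_flatCfg levelAction_flatCfg)
open NE3FlatHessianCurl (isUnitaryCfg_flatCfg smallField_flatCfg_zero)
open NE3EnergyShapes (IsUnitarySite IsPeriodicSite)
open NE7AdmissibleFibreLHC (chart_id_eq_chart_skewP)
open NE7MinimalOrbitDatumContinuity (thresholds)
open NE7MinimiserLipschitzPrep (norm_vary_sub_le)
open NE7MinimiserC1Flat (stab_flatCfg_const)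
open NE7FibreStraightening (fibre_straightening)
open NE7QuadraticGrowthSecondDerivative (second_derivative_ge_of_quadratic_growth)
open NE7SecondOrderChainRule (fderiv_fderiv_comp_of_fderiv_eq_zero fderiv_fderiv_comp_clm fderiv_fderiv_const_mul_sub)
open NE7MinActC2Lift (minAct_contDiffAt_two_of_lift)

noncomputable section

variable {n : Type} [Fintype n] [DecidableEq n]

set_option maxHeartbeats 2400000 in
/-- **THE HESSIAN OF THE CONSTRAINED MINIMAL ACTION AT THE FLAT DATUM = THE CONSTRAINED MINIMUM OF THE FREE QUADRATIC FORM** (see the module docstring): `m(y) = minAct(chart_1 y)`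
is `C²` at `0` and `D²m(0)[v,v]` is the LEAST element of `{w·D²𝒜(0)[X,X] : X ∈ skewSub M, levelQ′ 1 X = v}`. [folklore] -/
theorem minAct_hessian_flat [Nonempty n] {L : ℕ} [NeZero L] (hL : 2 ≤ L) :
    ∃ ε₀ : ℝ, 0 < ε₀ ∧ ∀ ε : ℝ, 0 < ε → ε ≤ ε₀ → ∀ (N : ℕ) [NeZero N], 1 ≤ N → ∀ j : ℕ,
      ContDiffAt ℝ 2 (fun y : ↥(skewSub 4 n N) => minAct 4 (sfClass 4 L N ε) L N (j + 1)
        (chart (ContinuousLinearMap.id ℝ (Matrix n n ℂ)) N (flatCfg : Site 4 → Fin 4 → (Matrix n n ℂ)ˣ) (y : TDir 4 n N))) 0 ∧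
      ∀ v : ↥(skewSub 4 n N),
        IsLeast {q : ℝ | ∃ X : ↥(skewSub 4 n (L * tower L N j)),
            levelQ' L N j (flatCfg : Site 4 → Fin 4 → (Matrix n n ℂ)ˣ) (X : TDir 4 n (L * tower L N j)) = v ∧
            q = ((stepWt 4 L)⁻¹) ^ (j + 1) * fderiv ℝ (fderiv ℝ (fun Φ : ↥(skewSub 4 n (L * tower L N j)) =>
              fineAction (chart (ContinuousLinearMap.id ℝ (Matrix n n ℂ)) (L * tower L N j) (flatCfg : Site 4 → Fin 4 → (Matrix n n ℂ)ˣ) (Φ : TDir 4 n (L * tower L N j)))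
                (perWin 4 (N * L ^ (j + 1))))) 0 X X}
          (fderiv ℝ (fderiv ℝ (fun y : ↥(skewSub 4 n N) => minAct 4 (sfClass 4 L N ε) L N (j + 1)
            (chart (ContinuousLinearMap.id ℝ (Matrix n n ℂ)) N (flatCfg : Site 4 → Fin 4 → (Matrix n n ℂ)ˣ) (y : TDir 4 n N)))) 0 v v) := by
  have hL1 : 1 ≤ L := by omega
  obtain ⟨ε₁, hε₁, H⟩ := thresholds (n := n) hL
  obtain ⟨ε₂, hε₂, H2⟩ := minAct_contDiffAt_two_of_lift (n := n) hL
  refine ⟨min ε₁ ε₂, lt_min hε₁ hε₂, fun ε hε hεle N _ hN j => ?_⟩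
  obtain ⟨-, -, hls, -⟩ := H ε hε (hεle.trans (min_le_left _ _))
  obtain ⟨δ₂, hδ₂, hC2⟩ := H2 ε hε (hεle.trans (min_le_right _ _)) N hN
  set M : ℕ := L * tower L N j with hM
  haveI : NeZero M := ⟨Nat.mul_ne_zero (NeZero.ne L) (tower_ne_zero L N j)⟩
  set V₀ : Site 4 → Fin 4 → (Matrix n n ℂ)ˣ := flatCfg with hV₀def
  set W := perWin 4 (N * L ^ (j + 1)) with hW
  set w : ℝ := ((stepWt 4 L)⁻¹) ^ (j + 1) with hw
  have hw0 : 0 < w := pow_pos (inv_pos.mpr (stepWt_pos (d := 4) L hL1)) _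
  have hlev : ∀ Z : Site 4 → Fin 4 → (Matrix n n ℂ)ˣ, levelAction 4 L N (j + 1) Z = w * fineAction Z W := fun Z => by rw [hw, hW]; rfl
  have hV₀u : IsUnitaryCfg V₀ := isUnitaryCfg_flatCfg
  have hV₀P : IsPeriodicCfg V₀ (N : ℤ) := isPeriodicCfg_flatCfg _
  have hV₀PM : IsPeriodicCfg V₀ ((L : ℤ) * (tower L N j : ℕ)) := isPeriodicCfg_flatCfg _
  have hUs : IsMinimiser 4 (sfClass 4 L N ε) L N (j + 1) V₀ V₀ := isMinimiser_sfClass_flatCfg hL1 N hε.le (j + 1)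
  set x₀ : ℝ := ε / ((L : ℝ) ^ (j + 1)) ^ 2 with hx₀
  have hx₀0 : 0 < x₀ := by positivity
  have hV₀x : SmallField V₀ x₀ := (flatCfg_mem_sfClass (d := 4) (n := n) L N hε.le (j + 1)).2.2
  have hV₀δ : SmallField V₀ δ₂ := by
    have h := (flatCfg_mem_sfClass (d := 4) (n := n) L N hδ₂.le 0).2.2
    simpa using h
  -- the lift hypothesis at the flat datum: stabilisers are constant gauges, which fix the flat fine configuration
  have hlift : ∀ s : Site 4 → (Matrix n n ℂ)ˣ, IsUnitarySite s → IsPeriodicSite s (N : ℤ) → gaugeAct s V₀ = V₀ →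
      ∃ h : Site 4 → (Matrix n n ℂ)ˣ, IsUnitarySite h ∧ IsPeriodicSite h ((N * L ^ (j + 1) : ℕ) : ℤ) ∧ gaugeAct h V₀ = V₀ ∧
        ∀ z : Site 4, h (((L : ℤ) ^ (j + 1)) • z) = s z := fun s hsu hsP hfix =>
    ⟨fun _ => s 0, fun _ => hsu 0, fun _ _ => rfl, by funext x κ; simp only [hV₀def, gaugeAct, flatCfg, mul_one, mul_inv_cancel],
      fun z => (stab_flatCfg_const hsP hfix z).symm⟩
  obtain ⟨Sl, θS, KT, iK, zs, hSlle, hθSc, hθS0, hfib1, hiK, hzsc, hzs0, hkey, -, -, hM2, hHess, -⟩ :=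
    hC2 V₀ ⟨hV₀u, hV₀P, hV₀δ⟩ j V₀ hUs hlift
  haveI : CompleteSpace ↥Sl := FiniteDimensional.complete ℝ _
  haveI : CompleteSpace ↥KT := FiniteDimensional.complete ℝ _
  haveI : CompleteSpace ↥(skewSub 4 n M) := FiniteDimensional.complete ℝ _
  haveI : CompleteSpace ↥(skewSub 4 n N) := FiniteDimensional.complete ℝ _
  refine ⟨hM2, fun v => ?_⟩
  -- the fine action on skew fields in the chart at the flat configuration: `C²`, `≥ 0 = 𝒜(0)`, hence critical at `0`
  set A : ↥(skewSub 4 n M) → ℝ := fun Φ => fineAction (chart (ContinuousLinearMap.id ℝ (Matrix n n ℂ)) M V₀ (Φ : TDir 4 n M)) W with hA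
  have hAc : ContDiffAt ℝ 2 A 0 := by
    have h1 : ContDiffAt ℝ 2 (fun Φ : TDir 4 n M => fineAction (chart (ContinuousLinearMap.id ℝ (Matrix n n ℂ)) M V₀ Φ) W) ((skewSub 4 n M).subtypeL 0) := by
      rw [map_zero]; exact contDiffAt_fineAction_chart (m := 2) (ContinuousLinearMap.id ℝ (Matrix n n ℂ)) M V₀ W 0
    exact h1.comp 0 (skewSub 4 n M).subtypeL.contDiff.contDiffAt
  have hA0 : A 0 = 0 := by simp only [hA, Submodule.coe_zero, chart_zero, hV₀def, fineAction_flatCfg]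
  have hAmin : IsLocalMin A 0 := Filter.Eventually.of_forall fun Φ => by
    rw [hA0]
    show 0 ≤ fineAction (chart (ContinuousLinearMap.id ℝ (Matrix n n ℂ)) M V₀ (Φ : TDir 4 n M)) W
    rw [chart_id_eq_chart_skewP _ Φ.2]
    exact fineAction_nonneg (isUnitaryCfg_chart M hV₀u _) W
  have hA' : fderiv ℝ A 0 = 0 := hAmin.fderiv_eq_zero
  -- the linearised averaging map `Q′` and its restriction to skew fields
  have hG : HasStrictFDerivAt (fun Φ : TDir 4 n M => levelQ L N j V₀ (chart (ContinuousLinearMap.id ℝ (Matrix n n ℂ)) M V₀ Φ)) (levelQ' L N j V₀) 0 :=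
    hasStrictFDerivAt_levelQ (d := 4) hL1 j hV₀u hV₀PM hx₀0.le (hls j) hV₀x
  have hm0 : minAct 4 (sfClass 4 L N ε) L N (j + 1) V₀ = 0 := by rw [hUs.minAct_eq, hV₀def, levelAction_flatCfg]
  constructor
  · -- THE MINIMUM IS ATTAINED at `X⋆ = Dθ_Σ(0)(v, ι_K z⋆′(0) v)`
    set ζ : ↥KT := fderiv ℝ zs 0 v with hζ
    set sX : ↥Sl := fderiv ℝ θS 0 (v, iK ζ) with hsX
    refine ⟨⟨(sX : TDir 4 n M), hSlle sX.2⟩, ?_, ?_⟩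
    · -- `Q′ X⋆ = v`: differentiate `Q̄(chart θ_Σ(p)) = p.1`
      have hΘd : HasFDerivAt (fun p : ↥(skewSub 4 n N) × ↥Sl => ((θS p : ↥Sl) : TDir 4 n M)) (Sl.subtypeL.comp (fderiv ℝ θS 0)) 0 :=
        Sl.subtypeL.hasFDerivAt.comp 0 (hθSc.differentiableAt (by simp)).hasFDerivAt
      have hΘ0 : (fun p : ↥(skewSub 4 n N) × ↥Sl => ((θS p : ↥Sl) : TDir 4 n M)) 0 = 0 := by simp only [hθS0, Submodule.coe_zero]
      have hG' : HasFDerivAt (fun Φ : TDir 4 n M => levelQ L N j V₀ (chart (ContinuousLinearMap.id ℝ (Matrix n n ℂ)) M V₀ Φ)) (levelQ' L N j V₀)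
          ((fun p : ↥(skewSub 4 n N) × ↥Sl => ((θS p : ↥Sl) : TDir 4 n M)) 0) := by rw [hΘ0]; exact hG.hasFDerivAt
      have hF := hG'.comp 0 hΘd
      have hF' : HasFDerivAt (fun p : ↥(skewSub 4 n N) × ↥Sl => levelQ L N j V₀ (chart (ContinuousLinearMap.id ℝ (Matrix n n ℂ)) M V₀ ((θS p : ↥Sl) : TDir 4 n M)))
          (ContinuousLinearMap.fst ℝ ↥(skewSub 4 n N) ↥Sl) 0 :=
        (hasFDerivAt_fst (𝕜 := ℝ) (p := (0 : ↥(skewSub 4 n N) × ↥Sl))).congr_of_eventuallyEq (hfib1.mono fun p hp => hp)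
      have heq := hF.unique hF'
      have h := congrArg (fun T : ↥(skewSub 4 n N) × ↥Sl →L[ℝ] ↥(skewSub 4 n N) => T (v, iK ζ)) heq
      simp only [ContinuousLinearMap.comp_apply, Submodule.subtypeL_apply, ContinuousLinearMap.coe_fst'] at h
      rw [hsX]; exact h
    · -- the value: `D²m(0)[v,v] = w·D²𝒜(0)[X⋆, X⋆]`
      set inclSl : ↥Sl →L[ℝ] ↥(skewSub 4 n M) := LinearMap.toContinuousLinearMap (Submodule.inclusion hSlle) with hinclSl
      set ι : ↥(skewSub 4 n N) × ↥KT →L[ℝ] ↥(skewSub 4 n N) × ↥Sl := (ContinuousLinearMap.id ℝ ↥(skewSub 4 n N)).prodMap iK with hι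
      set Θ : ↥(skewSub 4 n N) × ↥KT → ↥(skewSub 4 n M) := fun p => inclSl (θS (ι p)) with hΘ
      have hιp : ∀ p : ↥(skewSub 4 n N) × ↥KT, ι p = (p.1, iK p.2) := fun p => rfl
      have hΘval : ∀ p : ↥(skewSub 4 n N) × ↥KT, ((Θ p : ↥(skewSub 4 n M)) : TDir 4 n M) = ((θS (p.1, iK p.2) : ↥Sl) : TDir 4 n M) := fun p => rfl
      have hgΘ : (fun p : ↥(skewSub 4 n N) × ↥KT => fineAction (chart (ContinuousLinearMap.id ℝ (Matrix n n ℂ)) (L * tower L N j) V₀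
          ((θS (p.1, iK p.2) : ↥Sl) : TDir 4 n (L * tower L N j))) (perWin 4 (N * L ^ (j + 1)))) = fun p => A (Θ p) := by
        funext p
        show _ = fineAction (chart (ContinuousLinearMap.id ℝ (Matrix n n ℂ)) M V₀ ((Θ p : ↥(skewSub 4 n M)) : TDir 4 n M)) W
        rw [hΘval p]
      have hΘ0 : Θ 0 = 0 := by simp only [hΘ, map_zero, hθS0]
      have hΘc : ContDiffAt ℝ 2 Θ 0 := by
        have h1 : ContDiffAt ℝ 2 θS (ι 0) := by rw [map_zero]; exact hθSc
        exact inclSl.contDiff.contDiffAt.comp 0 (h1.comp 0 ι.contDiff.contDiffAt)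
      have hΘd : HasFDerivAt Θ (inclSl.comp ((fderiv ℝ θS 0).comp ι)) 0 := by
        have h1 : HasFDerivAt θS (fderiv ℝ θS 0) (ι 0) := by rw [map_zero]; exact (hθSc.differentiableAt (by simp)).hasFDerivAt
        exact inclSl.hasFDerivAt.comp 0 (h1.comp 0 ι.hasFDerivAt)
      have hAcΘ : ContDiffAt ℝ 2 A (Θ 0) := by rw [hΘ0]; exact hAc
      have hA'Θ : fderiv ℝ A (Θ 0) = 0 := by rw [hΘ0]; exact hA'
      have hD2 := fderiv_fderiv_comp_of_fderiv_eq_zero hAcΘ hΘc hA'Θ (v, ζ) (v, ζ)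
      have hTX : fderiv ℝ Θ 0 (v, ζ) = ⟨(sX : TDir 4 n M), hSlle sX.2⟩ := by
        rw [hΘd.fderiv]
        apply Subtype.ext
        simp only [ContinuousLinearMap.comp_apply, hιp, hinclSl, LinearMap.coe_toContinuousLinearMap', Submodule.coe_inclusion, hsX]
      rw [hHess v v, hgΘ, hD2, hΘ0, hTX]
  · -- THE LOWER BOUND: for every `X` with `Q′X = v`, `D²m(0)[v,v] ≤ w·D²𝒜(0)[X,X]`
    rintro q ⟨X, hXv, rfl⟩
    -- the fibre straightening `θ` at `(1, 1)`
    obtain ⟨θ, -, ρ₀, -, hρ₀, hθ0, hθc, -, hθid, hθfib⟩ :=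
      fibre_straightening (d := 4) (n := n) hL1 hε.le (hls j) hUs.mem hx₀0 (by rw [hV₀def]; exact smallField_flatCfg_zero)
    -- the derivative of `θ` along `(Q′X, X)` is `X`
    have hGs : HasFDerivAt (fun Φ : ↥(skewSub 4 n M) => levelQ L N j V₀ (chart (ContinuousLinearMap.id ℝ (Matrix n n ℂ)) M V₀ (Φ : TDir 4 n M)))
        ((levelQ' L N j V₀).comp (skewSub 4 n M).subtypeL) 0 := by
      have h1 : HasFDerivAt (fun Φ : TDir 4 n M => levelQ L N j V₀ (chart (ContinuousLinearMap.id ℝ (Matrix n n ℂ)) M V₀ Φ)) (levelQ' L N j V₀)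
          ((skewSub 4 n M).subtypeL 0) := by rw [map_zero]; exact hG.hasFDerivAt
      exact h1.comp 0 (skewSub 4 n M).subtypeL.hasFDerivAt
    have hGs0 : levelQ L N j V₀ (chart (ContinuousLinearMap.id ℝ (Matrix n n ℂ)) M V₀ (((0 : ↥(skewSub 4 n M)) : TDir 4 n M))) = 0 := by
      rw [Submodule.coe_zero, chart_zero, levelQ_self]
    have hJd : HasFDerivAt (fun Φ : ↥(skewSub 4 n M) => θ (levelQ L N j V₀ (chart (ContinuousLinearMap.id ℝ (Matrix n n ℂ)) M V₀ (Φ : TDir 4 n M)), Φ))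
        ((fderiv ℝ θ 0).comp (((levelQ' L N j V₀).comp (skewSub 4 n M).subtypeL).prod (ContinuousLinearMap.id ℝ ↥(skewSub 4 n M)))) 0 := by
      have h1 : ∀ p : ↥(skewSub 4 n N) × ↥(skewSub 4 n M), p = 0 → HasFDerivAt θ (fderiv ℝ θ 0) p := fun p hp => by
        rw [hp]; exact (hθc.differentiableAt (by simp)).hasFDerivAt
      exact (h1 _ (by simp only [hGs0, Prod.mk_zero_zero])).comp 0 (hGs.prodMk (hasFDerivAt_id (0 : ↥(skewSub 4 n M))))
    have hJid : HasFDerivAt (fun Φ : ↥(skewSub 4 n M) => θ (levelQ L N j V₀ (chart (ContinuousLinearMap.id ℝ (Matrix n n ℂ)) M V₀ (Φ : TDir 4 n M)), Φ))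
        (ContinuousLinearMap.id ℝ ↥(skewSub 4 n M)) 0 := by
      refine (hasFDerivAt_id (0 : ↥(skewSub 4 n M))).congr_of_eventuallyEq ?_
      filter_upwards [Metric.ball_mem_nhds (0 : ↥(skewSub 4 n M)) hρ₀] with Φ hΦ
      exact hθid Φ (by rwa [mem_ball_zero_iff] at hΦ)
    have hθ'X : fderiv ℝ θ 0 (v, X) = X := by
      have h := congrArg (fun T : ↥(skewSub 4 n M) →L[ℝ] ↥(skewSub 4 n M) => T X) (hJd.unique hJid)
      simp only [ContinuousLinearMap.comp_apply, ContinuousLinearMap.prod_apply, Submodule.subtypeL_apply, ContinuousLinearMap.id_apply] at h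
      rw [hXv] at h; exact h
    -- the competitor curve and its comparison function `φ(t) = w·𝒜(θ(tv, tX)) − m(tv)`
    set ℓ : ℝ →L[ℝ] ↥(skewSub 4 n N) × ↥(skewSub 4 n M) := ContinuousLinearMap.toSpanSingleton ℝ ((v, X) : ↥(skewSub 4 n N) × ↥(skewSub 4 n M)) with hℓ
    set ℓ' : ℝ →L[ℝ] ↥(skewSub 4 n N) := ContinuousLinearMap.toSpanSingleton ℝ v with hℓ'
    have hℓ1 : ℓ 1 = (v, X) := ContinuousLinearMap.toSpanSingleton_apply_one ℝ _
    have hℓ'1 : ℓ' 1 = v := ContinuousLinearMap.toSpanSingleton_apply_one ℝ _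
    have hℓfst : ∀ t : ℝ, (ℓ t).1 = ℓ' t := fun t => by simp only [hℓ, hℓ', ContinuousLinearMap.toSpanSingleton_apply, Prod.smul_fst]
    set m : ↥(skewSub 4 n N) → ℝ := fun y => minAct 4 (sfClass 4 L N ε) L N (j + 1) (chart (ContinuousLinearMap.id ℝ (Matrix n n ℂ)) N V₀ (y : TDir 4 n N)) with hm
    set f : ℝ → ℝ := fun t => A (θ (ℓ t)) with hf
    have hfc : ContDiffAt ℝ 2 f 0 := by
      have h1 : ContDiffAt ℝ 2 θ (ℓ 0) := by rw [map_zero]; exact hθc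
      have h2 : ContDiffAt ℝ 2 A (θ (ℓ 0)) := by rw [map_zero, hθ0]; exact hAc
      exact ContDiffAt.comp (g := A) (f := fun t : ℝ => θ (ℓ t)) 0 h2 (h1.comp 0 ℓ.contDiff.contDiffAt)
    have hmℓc : ContDiffAt ℝ 2 (fun t : ℝ => m (ℓ' t)) 0 := by
      have h1 : ContDiffAt ℝ 2 m (ℓ' 0) := by rw [map_zero]; exact hM2
      exact ContDiffAt.comp (g := m) (f := fun t : ℝ => ℓ' t) 0 h1 ℓ'.contDiff.contDiffAt
    have hφc : ContDiffAt ℝ 2 (fun t : ℝ => w * f t - m (ℓ' t)) 0 := (contDiffAt_const.mul hfc).sub hmℓc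
    -- `φ ≥ 0 = φ 0` near `0`: the competitor `chart_1 θ(tv, tX)` is admissible over `chart_1 (tv)`, where `θ_Σ` gives a minimiser
    have hφ0 : w * f 0 - m (ℓ' 0) = 0 := by
      simp only [hf, hm, map_zero, hθ0, hA0, mul_zero, Submodule.coe_zero, chart_zero, hm0, sub_zero]
    have htℓ : Tendsto (fun t : ℝ => ℓ t) (𝓝 0) (𝓝 0) := by have h := ℓ.continuous.tendsto 0; rwa [map_zero] at h
    have htℓ' : Tendsto (fun t : ℝ => ℓ' t) (𝓝 0) (𝓝 0) := by have h := ℓ'.continuous.tendsto 0; rwa [map_zero] at h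
    have hsmallρ : ∀ᶠ t : ℝ in 𝓝 0, ‖ℓ t‖ < ρ₀ :=
      htℓ.eventually (Filter.eventually_of_mem (Metric.ball_mem_nhds _ hρ₀) fun q hq => by rwa [mem_ball_zero_iff] at hq)
    have hsmall8 : ∀ᶠ t : ℝ in 𝓝 0, ‖ℓ' t‖ < 1 / 8 :=
      htℓ'.eventually (Filter.eventually_of_mem (Metric.ball_mem_nhds _ (by norm_num : (0:ℝ) < 1 / 8)) fun q hq => by rwa [mem_ball_zero_iff] at hq)
    have hgrowth : ∀ᶠ t : ℝ in 𝓝 0, 0 * ‖t - 0‖ ^ 2 ≤ (w * f t - m (ℓ' t)) - (w * f 0 - m (ℓ' 0)) := by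
      filter_upwards [hsmallρ, hsmall8, htℓ'.eventually hkey] with t htρ ht8 hmin
      rw [zero_mul, hφ0, sub_zero]
      set y : ↥(skewSub 4 n N) := ℓ' t with hy
      set D : Site 4 → Fin 4 → (Matrix n n ℂ)ˣ := chart (ContinuousLinearMap.id ℝ (Matrix n n ℂ)) N V₀ (y : TDir 4 n N) with hD
      have hDu : IsUnitaryCfg D := by rw [hD, chart_id_eq_chart_skewP V₀ y.2]; exact isUnitaryCfg_chart N hV₀u _
      have hDP : IsPeriodicCfg D (N : ℤ) := isPeriodicCfg_chart _ N hV₀P _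
      have hDnear : ∀ (r : Fin 4 → Fin N) (κ' : Fin 4),
          ‖(((V₀ (boxVec N r) κ')⁻¹ : (Matrix n n ℂ)ˣ) : Matrix n n ℂ) * (D (boxVec N r) κ' : Matrix n n ℂ) - 1‖ ≤ 1 / 4 := by
        intro r κ'
        have hcv : D = T4AveragingDeficitWall.vary V₀ (chartDir (ContinuousLinearMap.id ℝ (Matrix n n ℂ)) N (y : TDir 4 n N)) 1 := by
          rw [hD, ← chart_smul, one_smul]
        have hcomp : ‖chartDir (ContinuousLinearMap.id ℝ (Matrix n n ℂ)) N (y : TDir 4 n N) (boxVec N r) κ'‖ ≤ ‖y‖ := by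
          simp only [chartDir, ContinuousLinearMap.id_apply]
          rw [Submodule.coe_norm]
          exact (norm_le_pi_norm ((y : TDir 4 n N) (redN N (boxVec N r))) κ').trans (norm_le_pi_norm _ _)
        rw [hcv]
        exact (norm_vary_sub_le (W := V₀) (boxVec N r) κ' (hcomp.trans (by linarith))).trans (by linarith)
      have hDcoord : skewPR N (relLog N V₀ D) = y :=
        NE7MinimalActionDifferentiable.skewPR_relLog_chart_self V₀ y (lt_of_lt_of_le ht8 (by have := Real.log_two_gt_d9; linarith))
      have hp1 : (ℓ t).1 = y := hℓfst t
      have hadm : chart (ContinuousLinearMap.id ℝ (Matrix n n ℂ)) (L * tower L N j) V₀ ((θ (ℓ t) : ↥(skewSub 4 n (L * tower L N j))) : TDir 4 n (L * tower L N j))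
          ∈ admissible (sfClass 4 L N ε) L (j + 1) D :=
        (hθfib (ℓ t) htρ).2.2 D hDu hDP hDnear (by rw [hDcoord, hp1])
      have hle := hmin.minAct_le hadm
      rw [hlev] at hle
      show 0 ≤ w * A (θ (ℓ t)) - m y
      have e : m y = minAct 4 (sfClass 4 L N ε) L N (j + 1) D := rfl
      rw [e]; linarith
    have hφ'' := second_derivative_ge_of_quadratic_growth hφc le_rfl hgrowth 1
    rw [zero_mul] at hφ''
    -- `φ″(0) = w·D²𝒜(0)[X,X] − D²m(0)[v,v]`
    have hsplit := fderiv_fderiv_const_mul_sub hfc hmℓc w (1 : ℝ) 1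
    have hm'' : fderiv ℝ (fderiv ℝ (fun t : ℝ => m (ℓ' t))) 0 1 1 = fderiv ℝ (fderiv ℝ m) 0 v v := by
      have h1 : ContDiffAt ℝ 2 m (ℓ' 0) := by rw [map_zero]; exact hM2
      rw [fderiv_fderiv_comp_clm ℓ' h1, map_zero, hℓ'1]
    have hf'' : fderiv ℝ (fderiv ℝ f) 0 1 1 = fderiv ℝ (fderiv ℝ A) 0 X X := by
      have h1 : ContDiffAt ℝ 2 (fun p : ↥(skewSub 4 n N) × ↥(skewSub 4 n M) => A (θ p)) (ℓ 0) := by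
        rw [map_zero]
        have h2 : ContDiffAt ℝ 2 A (θ 0) := by rw [hθ0]; exact hAc
        exact ContDiffAt.comp (g := A) (f := θ) 0 h2 hθc
      have e1 : f = fun t => (fun p : ↥(skewSub 4 n N) × ↥(skewSub 4 n M) => A (θ p)) (ℓ t) := rfl
      rw [e1, fderiv_fderiv_comp_clm ℓ h1, map_zero, hℓ1]
      have hAθ : ContDiffAt ℝ 2 A (θ 0) := by rw [hθ0]; exact hAc
      have hA'θ : fderiv ℝ A (θ 0) = 0 := by rw [hθ0]; exact hA'
      rw [fderiv_fderiv_comp_of_fderiv_eq_zero hAθ hθc hA'θ, hθ0, hθ'X]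
    rw [hsplit, hm'', hf''] at hφ''
    show fderiv ℝ (fderiv ℝ m) 0 v v ≤ w * fderiv ℝ (fderiv ℝ A) 0 X X
    linarith

end

end Summit.QuantumFields.BalabanUV.T4Continuum.NE7MinActHessianFlat
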